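import Summits.AnomalousDissipation.AnomalousDissipation.Theorems.SoloBlindEnergyFloorLH
import Summits.AnomalousDissipation.AnomalousDissipation.Theorems.SoloBlindMomentumFlux

/-!
# Solo (blind) — the energy floor for Kolmogorov forcing with the sharp pointwise constant

Instance of `Theorems/SoloBlindEnergyFloorLH` (Doering–Foias energy floor with the semidefinite
constant) for the Kolmogorov force `f = cos(2πx₃)e₁` on `𝕋³` (`‖f‖₂² = ½`), with the multiplier
`Ψ = f` itself: `∇f` has the single entry `∂₃f₁ = −2π sin(2πx₃)`, so
`v·(∇f(x))v = −2π sin(2πx₃) v₁v₃ ≥ −π|v|²` — the SEMIDEFINITE constant is `c = π` (the Frobenius /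
operator-norm constant of the printed inequality is `2π`). Hence (`kolmogorov_energyBound_ge`):

  every vanishing-viscosity family of global Leray–Hopf solutions of `NS_{νⱼ}(cos(2πx₃)e₁)` with
  `meanEnergy (u j) ≤ E` has `E ≥ 1/(2π) ≈ 0.159`,

with no hypothesis on data, uniqueness, regularity or energy equality — to be read against the
drifted competitors of `Theorems/SoloBlindDriftStates` (every clause of `ZerothLaw` but the floor,
energies down to `1/(π√2) ≈ 0.225`). The optimum over all shear multipliers is the sawtooth
(`2/π² ≈ 0.203`, Doering–Eckhardt–Schumacher 2003; not smooth, not formalised here).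
[cite: DoeringFoias2002, §3] [cite: AlexakisDoering2006PLA, eq. (F1a)]
-/

open MeasureTheory Filter Topology Set UnitAddTorus
open scoped ENNReal NNReal InnerProductSpace

noncomputable section

namespace Summit.AnomalousDissipation.AnomalousDissipation.Theorems

open Literature.Analysis.FunctionSpaces Literature.Analysis.FunctionSpaces.Torus
open Literature.Analysis.FluidPDE

/-- The conjugate shear `g = sin(2πx₃)e₁` has vanishing second component. [folklore] -/
theorem kolSin_apply_one (y : UnitAddTorus (Fin 3)) : kolSin y 1 = 0 := by
  rw [kolSin, realTrigPoly_apply_coord, trigPoly_apply_coord]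
  simp [kolSinCoeff]

/-- The conjugate shear `g = sin(2πx₃)e₁` has vanishing third component. [folklore] -/
theorem kolSin_apply_two (y : UnitAddTorus (Fin 3)) : kolSin y 2 = 0 := by
  rw [kolSin, realTrigPoly_apply_coord, trigPoly_apply_coord]
  simp [kolSinCoeff]

/-- `‖g(y)‖ ≤ 1` pointwise. [folklore] -/
theorem norm_kolSin_le (y : UnitAddTorus (Fin 3)) : ‖kolSin y‖ ≤ 1 := by
  refine (norm_realTrigPoly_apply_le _ _ y).trans (le_of_eq ?_)
  rw [sum_kolModes, kolSinCoeff, kolSinCoeff, norm_smul, norm_smul, norm_kolVec]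
  simp [kolFreq]
  norm_num

/-- `g₁(y)² ≤ 1`. [folklore] -/
theorem kolSin_apply_zero_sq_le (y : UnitAddTorus (Fin 3)) : kolSin y 0 ^ 2 ≤ 1 := by
  have h1 : ‖kolSin y‖ ^ 2 ≤ 1 := by
    have h := norm_kolSin_le y
    nlinarith [norm_nonneg (kolSin y)]
  rw [EuclideanSpace.norm_sq_eq, Fin.sum_univ_three, kolSin_apply_one, kolSin_apply_two, norm_zero,
    Real.norm_eq_abs, sq_abs] at h1
  simpa using h1

/-- `⟪v, g(y)⟫ = v₁ g₁(y)`. [folklore] -/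
theorem inner_kolSin_eq (v : EuclideanSpace ℝ (Fin 3)) (y : UnitAddTorus (Fin 3)) :
    ⟪v, kolSin y⟫_ℝ = v 0 * kolSin y 0 := by
  simp [PiLp.inner_apply, Fin.sum_univ_three, kolSin_apply_one, kolSin_apply_two, mul_comm]

/-- **The sharp semidefinite constant of the Kolmogorov force**: `v·(∇f(y))v ≥ −π|v|²` for all
`y ∈ 𝕋³`, `v ∈ ℝ³` (`(v·∇)f = −2π v₃ g`, `⟪v,g⟫ = v₁g₁`, `|g₁| ≤ 1`, `2|v₁v₃| ≤ v₁² + v₃²`). [folklore] -/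
theorem semidefinite_kolForce (y : UnitAddTorus (Fin 3)) (v : EuclideanSpace ℝ (Fin 3)) :
    -(Real.pi * ‖v‖ ^ 2) ≤ ⟪v, Torus.convect (fun _ => v) kolForce y⟫_ℝ := by
  have hv : ‖v‖ ^ 2 = v 0 ^ 2 + v 1 ^ 2 + v 2 ^ 2 := by
    rw [EuclideanSpace.norm_sq_eq, Fin.sum_univ_three]
    simp only [Real.norm_eq_abs, sq_abs]
  rw [convect_kolForce, real_inner_smul_right, inner_kolSin_eq, hv]
  have hs := kolSin_apply_zero_sq_le y
  have hπ := Real.pi_pos.le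
  nlinarith [mul_nonneg hπ (sq_nonneg (v 0 - kolSin y 0 * v 2)), mul_nonneg hπ (sq_nonneg (v 0 + kolSin y 0 * v 2)),
    mul_nonneg hπ (mul_nonneg (sq_nonneg (v 2)) (sub_nonneg.2 hs)), mul_nonneg hπ (sq_nonneg (v 1))]

/-- **Energy floor under Kolmogorov forcing.** Every vanishing-viscosity family of global Leray–Hopf
weak solutions of `NS_{νⱼ}(cos(2πx₃)e₁)` on `𝕋³` (`νⱼ > 0`, `νⱼ → 0`, arbitrary data) whose mean
energies are bounded by `E` has `E ≥ 1/(2π)`. [cite: DoeringFoias2002, §3] -/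
theorem kolmogorov_energyBound_ge {ν : ℕ → ℝ}
    {u₀ : ℕ → UnitAddTorus (Fin 3) → EuclideanSpace ℝ (Fin 3)}
    {u : ℕ → ℝ → UnitAddTorus (Fin 3) → EuclideanSpace ℝ (Fin 3)} {E : ℝ}
    (hν : ∀ j, 0 < ν j) (hν₀ : Tendsto ν atTop (𝓝 0))
    (hu : ∀ j, Torus.IsGlobalLerayHopf (ν j) (fun _ => kolForce) (u₀ j) (u j))
    (hE : ∀ j, meanEnergy (u j) ≤ E) :
    1 / (2 * Real.pi) ≤ E := by
  have h := force_sq_le_strain_mul_energyBound_of_family hν hν₀ hu isSmooth_kolForce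
    isDivFree_kolForce hasZeroMean_kolForce Real.pi_pos.le semidefinite_kolForce hE
  rw [integral_norm_sq_kolForce] at h
  rw [div_le_iff₀ (by positivity)]
  linarith

/-- The same floor stated on the data of `Literature.Turb.ZerothLaw`: any would-be witness family
of the zeroth law built on the Kolmogorov force carries mean energy bound `E ≥ 1/(2π)`. [folklore] -/
theorem kolmogorov_witness_energyBound_ge {ν : ℕ → ℝ}
    {u₀ : ℕ → UnitAddTorus (Fin 3) → EuclideanSpace ℝ (Fin 3)}
    {u : ℕ → ℝ → UnitAddTorus (Fin 3) → EuclideanSpace ℝ (Fin 3)}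
    (hν : ∀ j, 0 < ν j) (hν₀ : Tendsto ν atTop (𝓝 0))
    (hu : ∀ j, Torus.IsGlobalLerayHopf (ν j) (fun _ => kolForce) (u₀ j) (u j))
    (hE : ∃ E : ℝ, ∀ j, meanEnergy (u j) ≤ E) :
    ∃ E : ℝ, (∀ j, meanEnergy (u j) ≤ E) ∧ ∀ E' : ℝ, (∀ j, meanEnergy (u j) ≤ E') → 1 / (2 * Real.pi) ≤ E' := by
  obtain ⟨E, hE⟩ := hE
  exact ⟨E, hE, fun E' hE' => kolmogorov_energyBound_ge hν hν₀ hu hE'⟩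

end Summit.AnomalousDissipation.AnomalousDissipation.Theorems
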